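import Summits.QuantumAdvantage.AdviceFreeQNC0.LowDegreeGapStrategies
import Summits.QuantumAdvantage.AdviceFreeQNC0.OneWindowStrategies
import Summits.QuantumAdvantage.AdviceFreeQNC0.LDMATransfer
import Summits.QuantumAdvantage.AdviceFreeQNC0.AugmentedCodePatterns
import HarnessLib

/-!
# Cell qa-qnc0 (rung F-Q1, route RingFrame, crux α `RingToElim`): a window content as a product
# of two blocks — Fubini, degrees, residue classes, light rows and columns, separation

Tools for the blind-window theorem (`ProductClassExtension.lean`, `CellParityObstruction.lean`).
A window content of `L + M` bits is read as `w = x ++ z` (`x ∈ {0,1}^L` the first `L` bits,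
`z ∈ {0,1}^M` the last `M`); the CELL `(i, j)` is `{w : |x| ≡ i, |z| ≡ j (mod 3)}`.

* `card_filter_blocks`, `card_filter_leftBlock`, `card_filter_rightBlock` — product counts;
* `hasDeg_leftBlock`, `hasDeg_rightBlock` — a function of one block, read on the product, keeps
  its degree;
* `four_mul_card_class_ge`, `sixteen_mul_card_cell_ge` — classes have `≥ 2^L/4` elements
  (`L ≥ 3`), cells `≥ 2^{L+M}/16`;
* `exists_row_le`, `exists_col_le` — averaging: some row / column of a prescribed residue class
  meets a small set in few points;
Elementary (the cell's bookkeeping, prover qn-prover-3, 2026-08-27). [folklore]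
WHAT THIS IS NOT: no statement about walk strategies or degrees of difficulty here; no separation.
-/
noncomputable section

namespace Summit.QuantumAdvantage.AdviceFreeQNC0

open Finset
open Literature.Computability.MetaComplexity Literature.Computability.MetaComplexity.Smolensky

variable {L M : ℕ}

/-! ### Fubini over the two blocks

A window content `w : Fin (L + M) → Bool` is `x ++ z` with `x = fun i => w (Fin.castAdd M i)` and
`z = fun j => w (Fin.natAdd L j)` (`Fin.append_castAdd_natAdd`; tree lemmas `left_of_append`,
`right_of_append`, `card_filter_eq_sum_left`, `card_filter_eq_sum_right`). -/

/-- A product count: `#{w : P (fun i : Fin L => w (Fin.castAdd M i)) ∧ Q (fun j : Fin M => w (Fin.natAdd L j))} = #{x : P x} · #{z : Q z}`. -/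
theorem card_filter_blocks (P : (Fin L → Bool) → Prop) (Q : (Fin M → Bool) → Prop)
    [DecidablePred P] [DecidablePred Q] :
    (univ.filter fun w : Fin (L + M) → Bool => P (fun i : Fin L => w (Fin.castAdd M i)) ∧ Q (fun j : Fin M => w (Fin.natAdd L j))).card =
      (univ.filter fun x : Fin L → Bool => P x).card * (univ.filter fun z : Fin M → Bool => Q z).card := by
  rw [card_filter_eq_sum_left]
  simp only [left_of_append, right_of_append]
  rw [Finset.card_filter (fun x : Fin L → Bool => P x), Finset.sum_mul]
  refine Finset.sum_congr rfl fun x _ => ?_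
  by_cases hx : P x
  · simp [hx]
  · simp [hx]

/-- A left-block count read on the product: `#{w : P (fun i : Fin L => w (Fin.castAdd M i))} = #{x : P x} · 2^M`. -/
theorem card_filter_leftBlock (P : (Fin L → Bool) → Prop) [DecidablePred P] :
    (univ.filter fun w : Fin (L + M) → Bool => P (fun i : Fin L => w (Fin.castAdd M i))).card =
      (univ.filter fun x : Fin L → Bool => P x).card * 2 ^ M := by
  have h := card_filter_blocks P (fun _ : Fin M → Bool => True)
  simp only [and_true, Finset.filter_true, Finset.card_univ, Fintype.card_fun, Fintype.card_bool,
    Fintype.card_fin] at h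
  exact h

/-- A right-block count read on the product: `#{w : Q (fun j : Fin M => w (Fin.natAdd L j))} = 2^L · #{z : Q z}`. -/
theorem card_filter_rightBlock (Q : (Fin M → Bool) → Prop) [DecidablePred Q] :
    (univ.filter fun w : Fin (L + M) → Bool => Q (fun j : Fin M => w (Fin.natAdd L j))).card =
      2 ^ L * (univ.filter fun z : Fin M → Bool => Q z).card := by
  have h := card_filter_blocks (fun _ : Fin L → Bool => True) Q
  simp only [true_and, Finset.filter_true, Finset.card_univ, Fintype.card_fun, Fintype.card_bool,
    Fintype.card_fin] at h
  exact h

/-! ### Degrees: a function of one block, read on the product -/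

/-- A function of the left block, read on `{0,1}^{L+M}`, keeps its degree. -/
theorem hasDeg_leftBlock {D : ℕ} {f : (Fin L → Bool) → Bool} (hf : HasDeg f D) :
    HasDeg (fun w : Fin (L + M) → Bool => f (fun i : Fin L => w (Fin.castAdd M i))) D := by
  unfold HasDeg at *
  refine comp_mem_lowDeg_of_coord (fun w : Fin (L + M) → Bool => fun i : Fin L => w (Fin.castAdd M i))
    (fun i => ?_) hf
  have : (fun w : Fin (L + M) → Bool => if w (Fin.castAdd M i) = true then (1 : ZMod 2) else 0) =
      mono (ZMod 2) {Fin.castAdd M i} := by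
    funext w; rw [mono_apply]; simp
  rw [this]
  exact mono_mem_lowDeg (by simp)

/-- A function of the right block, read on `{0,1}^{L+M}`, keeps its degree. -/
theorem hasDeg_rightBlock {D : ℕ} {f : (Fin M → Bool) → Bool} (hf : HasDeg f D) :
    HasDeg (fun w : Fin (L + M) → Bool => f (fun j : Fin M => w (Fin.natAdd L j))) D := by
  unfold HasDeg at *
  refine comp_mem_lowDeg_of_coord (fun w : Fin (L + M) → Bool => fun j : Fin M => w (Fin.natAdd L j))
    (fun j => ?_) hf
  have : (fun w : Fin (L + M) → Bool => if w (Fin.natAdd L j) = true then (1 : ZMod 2) else 0) =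
      mono (ZMod 2) {Fin.natAdd L j} := by
    funext w; rw [mono_apply]; simp
  rw [this]
  exact mono_mem_lowDeg (by simp)

/-- Masking by a constant keeps the degree. -/
theorem hasDeg_and_const' {k D : ℕ} {f : (Fin k → Bool) → Bool} (hf : HasDeg f D) (b : Bool) :
    HasDeg (fun u => f u && b) D := by
  cases b
  · have : (fun u => f u && false) = fun _ : Fin k → Bool => false := by funext u; simp
    rw [this]; exact hasDeg_false D
  · have : (fun u => f u && true) = f := by funext u; simp
    rw [this]; exact hf

/-! ### Residue classes and cells -/

/-- Every residue class of `{0,1}^L`, `L ≥ 3`, has at least `2^L / 4` elements. -/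
theorem four_mul_card_class_ge {L : ℕ} (hL : 3 ≤ L) (r : ℕ) :
    2 ^ L ≤ 4 * (univ.filter fun x : Fin L → Bool => wt x % 3 = r % 3).card := by
  have h := three_mul_card_class_add_two_ge L r
  have h8 : 8 ≤ 2 ^ L := by
    calc 8 = 2 ^ 3 := by norm_num
      _ ≤ 2 ^ L := Nat.pow_le_pow_right (by norm_num) hL
  omega

/-- Every cell of `{0,1}^{L+M}`, `L, M ≥ 3`, has at least `2^{L+M} / 16` elements. -/
theorem sixteen_mul_card_cell_ge (hL : 3 ≤ L) (hM : 3 ≤ M) (i j : ℕ) :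
    ((2 : ℝ) ^ (L + M)) ≤ 16 * ((univ.filter fun w : Fin (L + M) → Bool =>
      wt (fun i : Fin L => w (Fin.castAdd M i)) % 3 = i % 3 ∧ wt (fun j : Fin M => w (Fin.natAdd L j)) % 3 = j % 3).card : ℝ) := by
  have h := card_filter_blocks (fun x : Fin L → Bool => wt x % 3 = i % 3)
    (fun z : Fin M → Bool => wt z % 3 = j % 3)
  rw [h]
  have hx := four_mul_card_class_ge hL i
  have hz := four_mul_card_class_ge hM j
  have hxR : ((2 : ℝ) ^ L) ≤ 4 * ((univ.filter fun x : Fin L → Bool => wt x % 3 = i % 3).card : ℝ) := by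
    exact_mod_cast hx
  have hzR : ((2 : ℝ) ^ M) ≤ 4 * ((univ.filter fun z : Fin M → Bool => wt z % 3 = j % 3).card : ℝ) := by
    exact_mod_cast hz
  push_cast
  rw [pow_add]
  nlinarith [pow_pos (show (0:ℝ) < 2 by norm_num) L, pow_pos (show (0:ℝ) < 2 by norm_num) M]

/-! ### Averaging over rows and columns -/

/-- **Some row of a prescribed class is light.**  If `S ⊆ {0,1}^{L+M}` has `≤ ε·2^{L+M}` points
and `M ≥ 3`, some `z` with `|z| ≡ j` has `#{x : x ++ z ∈ S} ≤ 4ε·2^L`. -/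
theorem exists_row_le (hM : 3 ≤ M) (S : (Fin (L + M) → Bool) → Prop) [DecidablePred S] {ε : ℝ}
    (hS : ((univ.filter fun w : Fin (L + M) → Bool => S w).card : ℝ) ≤ ε * (2 : ℝ) ^ (L + M))
    (j : ℕ) : ∃ z : Fin M → Bool, wt z % 3 = j % 3 ∧
      ((univ.filter fun x : Fin L → Bool => S (Fin.append x z)).card : ℝ) ≤ 4 * ε * (2 : ℝ) ^ L := by
  classical
  have hTcard := four_mul_card_class_ge hM j
  set T := (univ.filter fun z : Fin M → Bool => wt z % 3 = j % 3) with hT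
  have hTne : T.Nonempty := by
    rw [← Finset.card_pos]
    have : 0 < 2 ^ M := Nat.two_pow_pos M
    omega
  -- the lightest row of the class
  obtain ⟨z₀, hz₀T, hmin⟩ := Finset.exists_min_image T
    (fun z => (univ.filter fun x : Fin L → Bool => S (Fin.append x z)).card) hTne
  refine ⟨z₀, (Finset.mem_filter.1 hz₀T).2, ?_⟩
  set f : (Fin M → Bool) → ℕ := fun z => (univ.filter fun x : Fin L → Bool => S (Fin.append x z)).card
    with hf
  -- `#T · f z₀ ≤ Σ_{z ∈ T} f z ≤ Σ_z f z = #S`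
  have h1 : T.card * f z₀ ≤ ∑ z ∈ T, f z := by
    have := Finset.card_nsmul_le_sum T f (f z₀) (fun z hz => hmin z hz)
    simpa using this
  have h2 : ∑ z ∈ T, f z ≤ ∑ z : Fin M → Bool, f z :=
    Finset.sum_le_sum_of_subset_of_nonneg (Finset.subset_univ T) (fun _ _ _ => Nat.zero_le _)
  have h3 : ∑ z : Fin M → Bool, f z = (univ.filter fun w : Fin (L + M) → Bool => S w).card := by
    rw [card_filter_eq_sum_right]
  have h4 : (T.card : ℝ) * (f z₀ : ℝ) ≤ ε * (2 : ℝ) ^ (L + M) := by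
    have : ((T.card * f z₀ : ℕ) : ℝ) ≤ ((univ.filter fun w : Fin (L + M) → Bool => S w).card : ℝ) := by
      exact_mod_cast (h1.trans (h2.trans h3.le))
    push_cast at this
    linarith
  have hTR : ((2 : ℝ) ^ M) ≤ 4 * (T.card : ℝ) := by exact_mod_cast hTcard
  have hpow : (2 : ℝ) ^ (L + M) = (2 : ℝ) ^ L * (2 : ℝ) ^ M := pow_add _ _ _
  have hf0 : (0 : ℝ) ≤ (f z₀ : ℝ) := Nat.cast_nonneg _
  have hεnn : 0 ≤ ε * (2 : ℝ) ^ (L + M) := le_trans (by positivity) h4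
  have hε : 0 ≤ ε := by
    have hp : (0 : ℝ) < (2 : ℝ) ^ (L + M) := by positivity
    nlinarith
  -- `f z₀ ≤ ε 2^{L+M} / #T ≤ 4 ε 2^L`
  have key : (f z₀ : ℝ) * (2 : ℝ) ^ M ≤ 4 * ε * (2 : ℝ) ^ L * (2 : ℝ) ^ M := by
    calc (f z₀ : ℝ) * (2 : ℝ) ^ M ≤ (f z₀ : ℝ) * (4 * (T.card : ℝ)) :=
          mul_le_mul_of_nonneg_left hTR hf0
      _ = 4 * ((T.card : ℝ) * (f z₀ : ℝ)) := by ring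
      _ ≤ 4 * (ε * (2 : ℝ) ^ (L + M)) := by linarith
      _ = 4 * ε * (2 : ℝ) ^ L * (2 : ℝ) ^ M := by rw [hpow]; ring
  exact le_of_mul_le_mul_right key (by positivity)

/-- **Some column of a prescribed class is light** (the symmetric statement). -/
theorem exists_col_le (hL : 3 ≤ L) (S : (Fin (L + M) → Bool) → Prop) [DecidablePred S] {ε : ℝ}
    (hS : ((univ.filter fun w : Fin (L + M) → Bool => S w).card : ℝ) ≤ ε * (2 : ℝ) ^ (L + M))
    (i : ℕ) : ∃ x : Fin L → Bool, wt x % 3 = i % 3 ∧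
      ((univ.filter fun z : Fin M → Bool => S (Fin.append x z)).card : ℝ) ≤ 4 * ε * (2 : ℝ) ^ M := by
  classical
  have hTcard := four_mul_card_class_ge hL i
  set T := (univ.filter fun x : Fin L → Bool => wt x % 3 = i % 3) with hT
  have hTne : T.Nonempty := by
    rw [← Finset.card_pos]
    have : 0 < 2 ^ L := Nat.two_pow_pos L
    omega
  obtain ⟨x₀, hx₀T, hmin⟩ := Finset.exists_min_image T
    (fun x => (univ.filter fun z : Fin M → Bool => S (Fin.append x z)).card) hTne
  refine ⟨x₀, (Finset.mem_filter.1 hx₀T).2, ?_⟩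
  set f : (Fin L → Bool) → ℕ := fun x => (univ.filter fun z : Fin M → Bool => S (Fin.append x z)).card
    with hf
  have h1 : T.card * f x₀ ≤ ∑ x ∈ T, f x := by
    have := Finset.card_nsmul_le_sum T f (f x₀) (fun x hx => hmin x hx)
    simpa using this
  have h2 : ∑ x ∈ T, f x ≤ ∑ x : Fin L → Bool, f x :=
    Finset.sum_le_sum_of_subset_of_nonneg (Finset.subset_univ T) (fun _ _ _ => Nat.zero_le _)
  have h3 : ∑ x : Fin L → Bool, f x = (univ.filter fun w : Fin (L + M) → Bool => S w).card := by
    rw [card_filter_eq_sum_left]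
  have h4 : (T.card : ℝ) * (f x₀ : ℝ) ≤ ε * (2 : ℝ) ^ (L + M) := by
    have : ((T.card * f x₀ : ℕ) : ℝ) ≤ ((univ.filter fun w : Fin (L + M) → Bool => S w).card : ℝ) := by
      exact_mod_cast (h1.trans (h2.trans h3.le))
    push_cast at this
    linarith
  have hTR : ((2 : ℝ) ^ L) ≤ 4 * (T.card : ℝ) := by exact_mod_cast hTcard
  have hpow : (2 : ℝ) ^ (L + M) = (2 : ℝ) ^ L * (2 : ℝ) ^ M := pow_add _ _ _
  have hf0 : (0 : ℝ) ≤ (f x₀ : ℝ) := Nat.cast_nonneg _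
  have key : (f x₀ : ℝ) * (2 : ℝ) ^ L ≤ 4 * ε * (2 : ℝ) ^ M * (2 : ℝ) ^ L := by
    calc (f x₀ : ℝ) * (2 : ℝ) ^ L ≤ (f x₀ : ℝ) * (4 * (T.card : ℝ)) :=
          mul_le_mul_of_nonneg_left hTR hf0
      _ = 4 * ((T.card : ℝ) * (f x₀ : ℝ)) := by ring
      _ ≤ 4 * (ε * (2 : ℝ) ^ (L + M)) := by linarith
      _ = 4 * ε * (2 : ℝ) ^ M * (2 : ℝ) ^ L := by rw [hpow]; ring
  exact le_of_mul_le_mul_right key (by positivity)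

end Summit.QuantumAdvantage.AdviceFreeQNC0
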